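import Summits.ResolutionOfSingularities.ResolutionOfSingularities.Theorems.MarkedTransferCampaignW21AlongCentreBounds
import HarnessLib

/-!
# [OURS · L1 W2.1] The weak bound AT `ξ` over the by-case operator `H♭ = HFlat.op` (Def. 9.12 «in all three cases»):
# `q ≤ ord_ξ H♭(ε)` in Cases (II) and (III) unconditionally, and in Case (I) when `|α + pβ| ≤ q` — every prime `p`

Rung L (rescue) of cell res-hironaka, RESCUE-SEED row L-G2, slot W2.1 (USE half), seat res-L1-s21-pv-1 (gen 2). Complement to
`MarkedTransferCampaignW21AlongCentreBounds.lean` (p500718, `weakBoundAtPoint_of_degree_le`): the consumed inequality AT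
the closed point, «ord_ξ(h) ≥ q» (what p.85 L10–L11 needs when `D = {ξ}`; cf. Eq. (83) (2) p.55 for the strict sibling,
NOT treated), over row 057's case-indexed operator `HFlat.op` (`= Def9_12`; case witness `c : HFlat.Case`, no tie-break in
print). Kernel form of res-L1-k21 KILL-TEST-K2.1 §6 (c) «under reading C2 (Case II taken first on the overlap) it never
fails at all»: in Case (II) and Case (III) the full bound `ord ε ≤ ord H♭(ε)` is a theorem for every prime
(`orderBoundCaseII_holds` p473059, `orderBoundCaseIIIPos_holds` p479111) and `q < ord ε` is a `Standing` binder; in Case (I)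
the weak bound holds as soon as the datum is not ALSO in Case (II) (`|α + pβ| ≤ q`). So the only data on which the
Case-(I) FORMULA violates the weak bound AT `ξ` are (I)∧(II)-overlap data evaluated with the Case-(I) formula (reading
C1; res-adj-2's W1, DOSSIER §3.3) — a tie-break question, not a class question. Everything here is OURS / folklore; nothing
is a statement of or about the manuscript under adjudication; AI review is weaker than expert review.
-/

noncomputable section

set_option linter.dupNamespace false -- mandated namespace of this single-conjunct summit

namespace Summit.ResolutionOfSingularities.ResolutionOfSingularities.Theorems

namespace CampaignW21

open Literature.AlgebraicGeometry.Hironaka2017.S08UnitMonomial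
open Literature.AlgebraicGeometry.Hironaka2017.S09LLUED
open Literature.AlgebraicGeometry.Hironaka2017.S09LLUED.TopFrontier
open Literature.AlgebraicGeometry.Resolution

/-- **Cases (II) and (III): `q < ord_ξ H♭(ε)`** for every prime, every `Standing` datum with `0 < e` (the full bound
`ord ε ≤ ord H♭(ε)` holds there, and `q < ord ε`). [folklore] -/
theorem lt_adicOrder_op_of_not_caseI (p : ℕ) [Fact p.Prime] (K : Type) [Field K] [CharP K p] (n e ℓ : ℕ) (he : 0 < e)
    (ε : MvPowerSeries (Fin n) K) (S : StandardExpression p (xs K n) e ℓ ε) (h0 : 0 < frontierLength S.support S.u)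
    (hS : Standing p e ℓ ε S h0)
    (c : HFlat.Case p (p ^ e) (alpha S.support S.u) (beta S.support S.u) (gamma S.support S.u ⟨0, h0⟩))
    (hc : ∀ h, c ≠ HFlat.Case.I h) :
    ((p ^ e : ℕ) : ℕ∞) <
      adicOrder (HFlat.op (xs K n) (hasseD K n) hS.unit_u0.unit p (p ^ e)
        (alpha S.support S.u) (beta S.support S.u) (gamma S.support S.u ⟨0, h0⟩) c ε) := by
  cases c with
  | I h => exact absurd rfl (hc h)
  | II h => exact lt_of_lt_of_le hS.ord_lt (orderBoundCaseII_holds p K n e ℓ ε S h0 hS h)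
  | III h => exact lt_of_lt_of_le hS.ord_lt (orderBoundCaseIIIPos_holds p K n e ℓ he ε S h0 hS h)

/-- **[OURS · L1 W2.1] The weak bound AT `ξ` over `HFlat.op`, all three cases**: for every prime `p`, every `Standing`
datum with `0 < e` and `|α + pβ| ≤ q`, and EVERY case witness `c`, `q ≤ ord_ξ H♭(ε)` (`H♭ = HFlat.op … c`). (On such data
Case (II) cannot occur, Case (I) is `weakBoundAtPoint_of_degree_le`, Case (III) is the full bound.) NOT a statement of
the manuscript. [folklore] -/
theorem weakBoundOp_of_degree_le (p : ℕ) [Fact p.Prime] (K : Type) [Field K] [CharP K p] (n e ℓ : ℕ) (he : 0 < e)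
    (ε : MvPowerSeries (Fin n) K) (S : StandardExpression p (xs K n) e ℓ ε) (h0 : 0 < frontierLength S.support S.u)
    (hS : Standing p e ℓ ε S h0) (hX : (alpha S.support S.u + p • beta S.support S.u).degree ≤ p ^ e)
    (c : HFlat.Case p (p ^ e) (alpha S.support S.u) (beta S.support S.u) (gamma S.support S.u ⟨0, h0⟩)) :
    ((p ^ e : ℕ) : ℕ∞) ≤
      adicOrder (HFlat.op (xs K n) (hasseD K n) hS.unit_u0.unit p (p ^ e)
        (alpha S.support S.u) (beta S.support S.u) (gamma S.support S.u ⟨0, h0⟩) c ε) := by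
  cases c with
  | I h => exact weakBoundAtPoint_of_degree_le p K n e ℓ he ε S h0 hS hX
  | II h => exact (lt_adicOrder_op_of_not_caseI p K n e ℓ he ε S h0 hS (HFlat.Case.II h) (fun _ h' => by cases h')).le
  | III h => exact (lt_adicOrder_op_of_not_caseI p K n e ℓ he ε S h0 hS (HFlat.Case.III h) (fun _ h' => by cases h')).le

/-- **[OURS · L1 W2.1] «Case (II) first» (reading C2): on the (I)∧(II) OVERLAP the weak bound AT `ξ` holds for the
Case-(II) value** (indeed strictly, `q < ord ε ≤ ord H♭_{II}(ε)`), every prime. Together with `weakBoundOp_of_degree_le`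
(data NOT in Case (II), any case witness): under the precedence «take Case (II) whenever it applies» the weak bound AT
`ξ` never fails — the kernel form of res-L1-k21 KILL-TEST-K2.1 §6 (c). NOT a statement of the manuscript. [folklore] -/
theorem lt_adicOrder_op_caseII (p : ℕ) [Fact p.Prime] (K : Type) [Field K] [CharP K p] (n e ℓ : ℕ) (he : 0 < e)
    (ε : MvPowerSeries (Fin n) K) (S : StandardExpression p (xs K n) e ℓ ε) (h0 : 0 < frontierLength S.support S.u)
    (hS : Standing p e ℓ ε S h0) (hII : IsCaseII p (p ^ e) (alpha S.support S.u) (beta S.support S.u)) :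
    ((p ^ e : ℕ) : ℕ∞) <
      adicOrder (HFlat.op (xs K n) (hasseD K n) hS.unit_u0.unit p (p ^ e)
        (alpha S.support S.u) (beta S.support S.u) (gamma S.support S.u ⟨0, h0⟩) (HFlat.Case.II hII) ε) :=
  lt_adicOrder_op_of_not_caseI p K n e ℓ he ε S h0 hS (HFlat.Case.II hII) (fun _ h' => by cases h')

end CampaignW21

end Summit.ResolutionOfSingularities.ResolutionOfSingularities.Theorems

end
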